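import Mathlib.Algebra.Order.BigOperators.Group.Finset
import Mathlib.Algebra.BigOperators.Intervals
import Mathlib.Order.Monotone.Basic
import Mathlib.Tactic
import HarnessLib

/-!
# Pseudo-cubic representations and cubicle profiles (Agnarsson–Lauria 2013, §5) — the arithmetic
# half of the edge-isoperimetric theorem in `ℤ^d`, part I

Topic `Literature/MathematicalPhysics/StatisticalMechanics`; continues `EIPSliceRecursion.lean`, which
reduced nested edge-isoperimetric solutions in `ℤ^{d}` ([MS20] Theorem 2.2 = Ahlswede–Bezrukov) to
ARITHMETIC: a chain (pointwise increasing in `N`) of non-increasing profiles `e(N) ⊢ N` whose cost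
`2·e(N)(0) + Σ_k EIP^{d−1}(e(N)(k))` is minimal.  Agnarsson–Lauria's cubicles `⟦N⟧^d` ([AL13] §5)
provide the chain; this file formalises their bookkeeping, entirely over `ℕ` (no lattice geometry):

* `pc m ℓ d = (m+1)^ℓ m^{d−ℓ}` — the **pseudo `d`-cubic numbers** `[m,ℓ]^d` ([AL13] Definition 5.1),
  with Pascal's rule `pc_succ` (`[m,ℓ+1]^d = [m,ℓ]^d + [m,ℓ]^{d−1}`, Claim 5.2) and monotonicity;
* `iroot d n` (`⌊n^{1/d}⌋` as an integer: `m^d ≤ n < (m+1)^d`), `plead d n` (the `ℓ` of the largest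
  pseudo `d`-cubic `≤ n`), `prem d n` (the remainder `n' = n − [m,ℓ]^d < [m,ℓ]^{d−1}`) — the **pseudo
  `d`-cubic representation** `n = [m_d,ℓ_d]^d + n'` ([AL13] Proposition 5.3, greedy step) with its
  uniqueness `iroot_plead_unique`;
* `boxPerim m ℓ d = 2(ℓ[m,ℓ−1]^{d−1} + (d−ℓ)[m,ℓ]^{d−1})` — the edge perimeter of the box
  `[m+1]^ℓ × [m]^{d−ℓ} ⊂ ℤ^d`, and `cubicleCost d n = Σ_i boxPerim(m_i,ℓ_i,i)` over the PCR of `n`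
  — [AL13] Observation 5.12 / Theorem 6.4's `2δ_d(n)` (`= 2dn − 2F_d(n)`, the edge perimeter of the
  cubicle `⟦n⟧^d`; that it equals `EIP^d(n)` is Theorem 6.4, NOT proved in this file), with the
  recursions `cubicleCost_eq` (eq. (F(n)-rec)) and `boxPerim_succ` (eq. (F(pc)-rec)) in boundary form;
* `cubicleSlices d N : ℕ → ℕ` — the slice cardinalities of `⟦N⟧^d` along its last axis (a profile
  over `ℤ^{d−1}`: `m` slices `[m,ℓ]^{d−1} + (profile of ⟦n'⟧^{d−1})` if `ℓ ≤ d−2`, and `m` slices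
  `(m+1)^{d−1}` plus one slice `n'` if `ℓ = d−1`; [AL13] eq. (cubicle-rec) read slice by slice), with
  `sum_cubicleSlices` (`Σ = N`, Proposition 5.7 (i)), `cubicleSlices_antitone`, support and size
  bounds, `cubicleSlices_mono` (pointwise in `N`: Proposition 5.7 (ii), `⟦N⟧ ⊆ ⟦N+1⟧`), and
  `cubicleSlices_cost` (`2·e(0) + Σ_k cubicleCost (d−1) (e k) = cubicleCost d N`: the perimeter of
  a stack of `(d−1)`-cubicles with the cubicle profile is `2δ_d(N)`, eq. (F(n)-rec)/(F(pc)-sliced)).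

With `EIPSliceRecursion.isNestedMinimizerFamily_famStack_of_chain` this leaves, for nested solutions
in every `ℤ^d` (and the discharge of `MaininiSchmidt2020_cor33` via `MaininiSchmidt2020_cor33_of_nested'`),
exactly [AL13] §5 (statements P, P') – §6: `cubicleCost d N ≤ cubicleCost d (N − k) + cubicleCost (d−1) k`
for `1 ≤ k ≤ N/(m_d+1)` and the induction `E = F` on `d + n` — part II, not in this file.

Source: G. Agnarsson, K. Lauria, *Extremal subgraphs of the d-dimensional grid graph*,
arXiv:1302.6517 [AgnarssonLauria2013] (store key `paper:arxiv-1302.6517`, §5 = chunks p0008–p0010).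
Everything here is PROVED (definitions with bodies + lemmas); no named facts.
-/

namespace Literature.MathematicalPhysics.StatisticalMechanics

open Finset

/-! ### Pseudo-cubic numbers `[m,ℓ]^d = (m+1)^ℓ m^{d−ℓ}` ([AL13] Definition 5.1, Claim 5.2) -/

section PseudoCubic

/-- The **pseudo `d`-cubic number** `[m,ℓ]^d := (m+1)^ℓ · m^{d−ℓ}` (meaningful for `ℓ ≤ d`; the number
of points of the pseudo `d`-cube `[m+1]^ℓ × [m]^{d−ℓ}`; `[m,d]^d = [m+1,0]^d`).
[cite: AgnarssonLauria2013, Definition 5.1] -/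
def pc (m ℓ d : ℕ) : ℕ := (m + 1) ^ ℓ * m ^ (d - ℓ)

/-- `[m,0]^d = m^d`. [cite: AgnarssonLauria2013, Definition 5.1] -/
@[simp] theorem pc_zero_left (m d : ℕ) : pc m 0 d = m ^ d := by simp [pc]

/-- `[m,d]^d = (m+1)^d` (`= [m+1,0]^d`). [cite: AgnarssonLauria2013, Definition 5.1 (remark (ii))] -/
@[simp] theorem pc_self (m d : ℕ) : pc m d d = (m + 1) ^ d := by simp [pc]

/-- `[0,ℓ]^d = 0` for `ℓ < d`. [cite: AgnarssonLauria2013, Definition 5.1] -/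
theorem pc_zero_base {ℓ d : ℕ} (h : ℓ < d) : pc 0 ℓ d = 0 := by
  simp [pc, zero_pow (Nat.sub_ne_zero_of_lt h)]

/-- **Pascal's rule for pseudo-cubics**: `[m,ℓ+1]^d = [m,ℓ]^d + [m,ℓ]^{d−1}` (`ℓ + 1 ≤ d`) — the
difference of consecutive pseudo `d`-cubics is a pseudo `(d−1)`-cubic. [cite: AgnarssonLauria2013, Claim 5.2] -/
theorem pc_succ (m ℓ : ℕ) {d : ℕ} (h : ℓ + 1 ≤ d) : pc m (ℓ + 1) d = pc m ℓ d + pc m ℓ (d - 1) := by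
  unfold pc
  obtain ⟨r, rfl⟩ : ∃ r, d = ℓ + 1 + r := ⟨d - (ℓ + 1), by omega⟩
  rw [show ℓ + 1 + r - (ℓ + 1) = r by omega, show ℓ + 1 + r - ℓ = r + 1 by omega,
    show ℓ + 1 + r - 1 - ℓ = r by omega, pow_succ, pow_succ]
  ring

/-- `[m,ℓ]^{ℓ+r} = (m+1)^ℓ m^r` (the subtraction-free form). [cite: AgnarssonLauria2013, Definition 5.1] -/
theorem pc_add (m ℓ r : ℕ) : pc m ℓ (ℓ + r) = (m + 1) ^ ℓ * m ^ r := by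
  simp [pc]

/-- `[m,ℓ]^{ℓ+r}` with the summands commuted. [cite: AgnarssonLauria2013, Definition 5.1] -/
theorem pc_add' (m ℓ r : ℕ) : pc m ℓ (r + ℓ) = (m + 1) ^ ℓ * m ^ r := by
  rw [add_comm, pc_add]

/-- `m · [m,ℓ]^d = [m,ℓ]^{d+1}` (`ℓ ≤ d`): a pseudo `(d+1)`-cube is `m` slices of a pseudo `d`-cube.
[cite: AgnarssonLauria2013, §5 eq. (F(pc)-sliced)] -/
theorem mul_pc (m ℓ : ℕ) {d : ℕ} (h : ℓ ≤ d) : m * pc m ℓ d = pc m ℓ (d + 1) := by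
  unfold pc
  rw [show d + 1 - ℓ = d - ℓ + 1 by omega, pow_succ]
  ring

/-- Pseudo-cubics increase with `ℓ` (`ℓ ≤ ℓ' ≤ d`). [cite: AgnarssonLauria2013, Claim 5.2 (lexicographic monotonicity)] -/
theorem pc_mono_right (m : ℕ) {ℓ ℓ' d : ℕ} (h : ℓ ≤ ℓ') (h' : ℓ' ≤ d) : pc m ℓ d ≤ pc m ℓ' d := by
  induction ℓ', h using Nat.le_induction with
  | base => exact le_rfl
  | succ k hk ih =>
    rw [pc_succ m k h']
    exact (ih (by omega)).trans (Nat.le_add_right _ _)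

/-- `m^d ≤ [m,ℓ]^d ≤ (m+1)^d` (`ℓ ≤ d`). [cite: AgnarssonLauria2013, §5 (every n lies between two pseudo d-cubics)] -/
theorem pow_le_pc (m : ℕ) {ℓ d : ℕ} (h : ℓ ≤ d) : m ^ d ≤ pc m ℓ d := by
  rw [← pc_zero_left]; exact pc_mono_right m (Nat.zero_le _) h

/-- `[m,ℓ]^d ≤ (m+1)^d` (`ℓ ≤ d`). [cite: AgnarssonLauria2013, §5] -/
theorem pc_le_succ_pow (m : ℕ) {ℓ d : ℕ} (h : ℓ ≤ d) : pc m ℓ d ≤ (m + 1) ^ d := by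
  rw [← pc_self]; exact pc_mono_right m h le_rfl

/-- Pseudo-cubics increase with the base: `[m,ℓ]^d ≤ [m',0]^d` for `m < m'` (`ℓ ≤ d`) — with
`pc_mono_right`, the lexicographic monotonicity of Claim 5.2. [cite: AgnarssonLauria2013, Claim 5.2] -/
theorem pc_le_pc_of_lt (ℓ : ℕ) {m m' d : ℕ} (hm : m < m') (h : ℓ ≤ d) (ℓ' : ℕ) (h' : ℓ' ≤ d) :
    pc m ℓ d ≤ pc m' ℓ' d :=
  (pc_le_succ_pow m h).trans ((Nat.pow_le_pow_left hm d).trans (pow_le_pc m' h'))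

/-- `[m,ℓ]^d ≥ 1` for `m ≥ 1`. [cite: AgnarssonLauria2013, Definition 5.1] -/
theorem pc_pos {m : ℕ} (hm : 1 ≤ m) (ℓ d : ℕ) : 0 < pc m ℓ d := by
  unfold pc; positivity

end PseudoCubic

/-! ### The pseudo-cubic representation `n = [m,ℓ]^d + n'` ([AL13] Proposition 5.3) -/

section PCR

/-- The integer `d`-th root: the `m` with `m^d ≤ n < (m+1)^d` (`d ≥ 1`), i.e. `m_d = ⌊n^{1/d}⌋` of the
PCR. [cite: AgnarssonLauria2013, Proposition 5.3 (remark (i): m_d = ⌊n^{1/d}⌋)] -/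
def iroot (d n : ℕ) : ℕ := Nat.findGreatest (fun m => m ^ d ≤ n) n

variable {d : ℕ}

/-- `(iroot d n)^d ≤ n` (`d ≥ 1`). [cite: AgnarssonLauria2013, Proposition 5.3] -/
theorem iroot_pow_le (hd : 1 ≤ d) (n : ℕ) : iroot d n ^ d ≤ n :=
  Nat.findGreatest_spec (P := fun m => m ^ d ≤ n) (Nat.zero_le n)
    (by rw [zero_pow (by omega)]; exact Nat.zero_le n)

/-- `n < (iroot d n + 1)^d` (`d ≥ 1`). [cite: AgnarssonLauria2013, Proposition 5.3] -/
theorem lt_succ_iroot_pow (hd : 1 ≤ d) (n : ℕ) : n < (iroot d n + 1) ^ d := by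
  by_contra h
  push Not at h
  have h1 : iroot d n + 1 ≤ n :=
    (Nat.le_self_pow (by omega) _).trans h
  exact Nat.findGreatest_is_greatest (lt_add_one _) h1 h

/-- Uniqueness: `m^d ≤ n < (m+1)^d` forces `m = iroot d n`. [cite: AgnarssonLauria2013, Proposition 5.3 (uniqueness)] -/
theorem iroot_eq_of_bounds (hd : 1 ≤ d) {n m : ℕ} (h1 : m ^ d ≤ n) (h2 : n < (m + 1) ^ d) :
    iroot d n = m := by
  have a := iroot_pow_le hd n
  have b := lt_succ_iroot_pow hd n
  by_contra hne
  rcases Nat.lt_or_gt_of_ne hne with h | h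
  · have := Nat.pow_le_pow_left (show iroot d n + 1 ≤ m by omega) d
    omega
  · have := Nat.pow_le_pow_left (show m + 1 ≤ iroot d n by omega) d
    omega

/-- `iroot d n ≥ 1` for `n ≥ 1`. [cite: AgnarssonLauria2013, Proposition 5.3 (c, m_c ≥ 1)] -/
theorem iroot_pos (hd : 1 ≤ d) {n : ℕ} (hn : 1 ≤ n) : 1 ≤ iroot d n := by
  by_contra h
  have h0 : iroot d n = 0 := by omega
  have := lt_succ_iroot_pow hd n
  rw [h0, zero_add, one_pow] at this
  omega

/-- `iroot` is monotone. [cite: AgnarssonLauria2013, Observation 5.4] -/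
theorem iroot_mono (hd : 1 ≤ d) {n n' : ℕ} (h : n ≤ n') : iroot d n ≤ iroot d n' := by
  by_contra hc
  push Not at hc
  have h1 := Nat.pow_le_pow_left (show iroot d n' + 1 ≤ iroot d n by omega) d
  have h2 := iroot_pow_le hd n
  have h3 := lt_succ_iroot_pow hd n'
  omega

/-- The `ℓ` of the PCR: the largest `ℓ ≤ d − 1` with `[m_d,ℓ]^d ≤ n`. [cite: AgnarssonLauria2013, Proposition 5.3 (ℓ_d)] -/
def plead (d n : ℕ) : ℕ := Nat.findGreatest (fun ℓ => pc (iroot d n) ℓ d ≤ n) (d - 1)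

/-- `plead d n ≤ d − 1`. [cite: AgnarssonLauria2013, Proposition 5.3 (ℓ_d ∈ {0,…,d−1})] -/
theorem plead_le (d n : ℕ) : plead d n ≤ d - 1 := Nat.findGreatest_le _

/-- The leading pseudo-cubic is `≤ n`: `[m_d,ℓ_d]^d ≤ n`. [cite: AgnarssonLauria2013, Proposition 5.3] -/
theorem pc_plead_le (hd : 1 ≤ d) (n : ℕ) : pc (iroot d n) (plead d n) d ≤ n :=
  Nat.findGreatest_spec (P := fun ℓ => pc (iroot d n) ℓ d ≤ n) (Nat.zero_le _)
    (by rw [pc_zero_left]; exact iroot_pow_le hd n)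

/-- The next pseudo-cubic exceeds `n`: `n < [m_d,ℓ_d+1]^d`. [cite: AgnarssonLauria2013, Proposition 5.3 ([m_d,ℓ_d]^d ≤ n < [m_d,ℓ_d+1]^d)] -/
theorem lt_pc_plead_succ (hd : 1 ≤ d) (n : ℕ) : n < pc (iroot d n) (plead d n + 1) d := by
  by_cases h : plead d n + 1 ≤ d - 1
  · by_contra hc
    push Not at hc
    exact Nat.findGreatest_is_greatest (lt_add_one _) h hc
  · have h1 : plead d n = d - 1 := by have := plead_le d n; omega
    rw [h1, show d - 1 + 1 = d by omega, pc_self]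
    exact lt_succ_iroot_pow hd n

/-- **Uniqueness of the leading term of the PCR**: if `m ≥ 1`, `ℓ ≤ d−1` and
`[m,ℓ]^d ≤ n < [m,ℓ+1]^d`, then `(m, ℓ) = (m_d, ℓ_d)`. [cite: AgnarssonLauria2013, Proposition 5.3 (uniqueness of the d-PCR)] -/
theorem iroot_plead_unique (hd : 1 ≤ d) {n m ℓ : ℕ} (hℓ : ℓ ≤ d - 1)
    (h1 : pc m ℓ d ≤ n) (h2 : n < pc m (ℓ + 1) d) : iroot d n = m ∧ plead d n = ℓ := by
  have hm : iroot d n = m :=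
    iroot_eq_of_bounds hd ((pow_le_pc m (by omega)).trans h1)
      (lt_of_lt_of_le h2 (pc_le_succ_pow m (by omega)))
  refine ⟨hm, ?_⟩
  unfold plead
  rw [hm, Nat.findGreatest_eq_iff]
  refine ⟨hℓ, fun _ => h1, fun k hk hkd => ?_⟩
  push Not
  exact lt_of_lt_of_le h2 (pc_mono_right m hk (by omega))

/-- The remainder `n' = n − [m_d,ℓ_d]^d` of the PCR. [cite: AgnarssonLauria2013, Proposition 5.3 (n = [m_d,ℓ_d]^d + n')] -/
def prem (d n : ℕ) : ℕ := n - pc (iroot d n) (plead d n) d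

/-- The pseudo `(d−1)`-cubic `Δ = [m_d,ℓ_d]^{d−1} = [n]_+ − [n]_−` (the slice of the leading pseudo
`d`-cube; `n' < Δ`). [cite: AgnarssonLauria2013, §5 Notation (iii) ([n]^{d-1}_Δ)] -/
def pdelta (d n : ℕ) : ℕ := pc (iroot d n) (plead d n) (d - 1)

/-- `n = [m_d,ℓ_d]^d + n'`. [cite: AgnarssonLauria2013, Proposition 5.3] -/
theorem pc_add_prem (hd : 1 ≤ d) (n : ℕ) : pc (iroot d n) (plead d n) d + prem d n = n := by
  unfold prem; have := pc_plead_le hd n; omega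

/-- **`n' < [m_d,ℓ_d]^{d−1}`**: the remainder is smaller than the slice of the leading pseudo-cube.
[cite: AgnarssonLauria2013, §5 Notation (i) (n' < [m_d,ℓ_d]^{d-1})] -/
theorem prem_lt_pdelta (hd : 1 ≤ d) (n : ℕ) : prem d n < pdelta d n := by
  have h1 := lt_pc_plead_succ hd n
  have h2 := pc_plead_le hd n
  have hℓ := plead_le d n
  rw [pc_succ _ _ (show plead d n + 1 ≤ d by omega)] at h1
  unfold prem pdelta
  omega

/-- For `n ≥ 1` the leading base is positive and the leading pseudo-cubic is positive.
[cite: AgnarssonLauria2013, Proposition 5.3] -/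
theorem pc_iroot_plead_pos (hd : 1 ≤ d) {n : ℕ} (hn : 1 ≤ n) :
    0 < pc (iroot d n) (plead d n) d :=
  pc_pos (iroot_pos hd hn) _ _

/-- `prem d n < n` for `n ≥ 1`. [cite: AgnarssonLauria2013, Proposition 5.3 (induction on n)] -/
theorem prem_lt (hd : 1 ≤ d) {n : ℕ} (hn : 1 ≤ n) : prem d n < n := by
  have := pc_iroot_plead_pos hd hn
  have h2 := pc_add_prem hd n
  omega

/-- The PCR of a pseudo-cubic number is itself: remainder `0`. [cite: AgnarssonLauria2013, Proposition 5.3] -/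
theorem prem_pc {m ℓ : ℕ} (hd : 1 ≤ d) (hm : 1 ≤ m) (hℓ : ℓ ≤ d - 1) : prem d (pc m ℓ d) = 0 := by
  obtain ⟨h1, h2⟩ := iroot_plead_unique hd (n := pc m ℓ d) hℓ le_rfl
    (by rw [pc_succ m ℓ (by omega)]; exact Nat.lt_add_of_pos_right (pc_pos hm _ _))
  unfold prem; rw [h1, h2]; exact Nat.sub_self _

end PCR

/-! ### Box perimeters and the cubicle cost `2δ_d(n)` ([AL13] §5, Observation 5.12) -/

section Cost

/-- The edge perimeter `#Θ_d` of the pseudo `d`-cube `[m+1]^ℓ × [m]^{d−ℓ} ⊂ ℤ^d` (`ℓ ≤ d`): two faces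
per direction, `(m+1)^{ℓ−1} m^{d−ℓ}` points on a face orthogonal to a long direction and
`(m+1)^ℓ m^{d−ℓ−1}` on a face orthogonal to a short one — `2(ℓ[m,ℓ−1]^{d−1} + (d−ℓ)[m,ℓ]^{d−1})`,
the boundary form `2d·[m,ℓ]^d − 2F_d([m,ℓ]^d)` of [AL13] eq. (F(pc)-exactl).
[cite: AgnarssonLauria2013, §5 eq. (F(pc)-exactl) and Observation 5.12] -/
def boxPerim (m ℓ d : ℕ) : ℕ := 2 * (ℓ * pc m (ℓ - 1) (d - 1) + (d - ℓ) * pc m ℓ (d - 1))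

/-- The cube: `boxPerim m 0 d = 2d·m^{d−1}`. [cite: AgnarssonLauria2013, Proposition 3.2 (equality for d-th powers)] -/
theorem boxPerim_zero (m d : ℕ) : boxPerim m 0 d = 2 * (d * m ^ (d - 1)) := by
  simp [boxPerim]

/-- In dimension one every non-trivial box (interval) has perimeter `2`.
[cite: AgnarssonLauria2013, §5 (d = 1)] -/
theorem boxPerim_dim_one (m : ℕ) : boxPerim m 0 1 = 2 := by simp [boxPerim, pc]

/-- The convention `[m,d]^d = [m+1,0]^d` at the level of perimeters: `boxPerim m d d = boxPerim (m+1) 0 d`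
(`= 2d(m+1)^{d−1}`). [cite: AgnarssonLauria2013, Definition 5.1 (remark (ii))] -/
theorem boxPerim_self (m d : ℕ) : boxPerim m d d = boxPerim (m + 1) 0 d := by
  simp [boxPerim, pc]

/-- **[AL13] eq. (F(pc)-rec) in boundary form**: `boxPerim m (ℓ+1) d = boxPerim m ℓ d + boxPerim m ℓ (d−1)`
(`ℓ + 1 ≤ d`): growing the pseudo-cube by one slab adds the perimeter of the slab's cross-section.
[cite: AgnarssonLauria2013, §5 eq. (F(pc)-rec)] -/
theorem boxPerim_succ (m ℓ : ℕ) {d : ℕ} (h : ℓ + 1 ≤ d) :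
    boxPerim m (ℓ + 1) d = boxPerim m ℓ d + boxPerim m ℓ (d - 1) := by
  obtain ⟨r, rfl⟩ : ∃ r, d = ℓ + 1 + r := ⟨d - (ℓ + 1), by omega⟩
  unfold boxPerim
  rw [show ℓ + 1 - 1 = ℓ by omega, show ℓ + 1 + r - 1 = ℓ + r by omega,
    show ℓ + 1 + r - (ℓ + 1) = r by omega, show ℓ + 1 + r - ℓ = r + 1 by omega,
    show ℓ + r - ℓ = r by omega, pc_add]
  rcases Nat.eq_zero_or_pos r with rfl | hr
  · rcases Nat.eq_zero_or_pos ℓ with rfl | hℓ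
    · simp [pc]
    · obtain ⟨t, rfl⟩ : ∃ t, ℓ = t + 1 := ⟨ℓ - 1, by omega⟩
      rw [show t + 1 + 0 = t + 1 by omega, show t + 1 - 1 = t by omega, pc_add, pc_self]
      ring
  · obtain ⟨s, rfl⟩ : ∃ s, r = s + 1 := ⟨r - 1, by omega⟩
    rw [show ℓ + (s + 1) = (ℓ + 1) + s by omega, pc_add, show ℓ + 1 + s - 1 = ℓ + s by omega,
      pc_add]
    rcases Nat.eq_zero_or_pos ℓ with rfl | hℓ
    · ring
    · obtain ⟨t, rfl⟩ : ∃ t, ℓ = t + 1 := ⟨ℓ - 1, by omega⟩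
      rw [show t + 1 - 1 = t by omega, show t + 1 + 1 + s = t + (s + 2) by omega, pc_add,
        show t + 1 + s = t + (s + 1) by omega, pc_add]
      ring

/-- **[AL13] eq. (F(pc)-sliced) in boundary form**: `boxPerim m ℓ (d+1) = 2·[m,ℓ]^d + m·boxPerim m ℓ d`
(`ℓ ≤ d`): the pseudo `(d+1)`-cube is a stack of `m` pseudo `d`-cubes `[m,ℓ]^d`, costing twice the
cross-section plus `m` cross-section perimeters. [cite: AgnarssonLauria2013, §5 eq. (F(pc)-sliced)] -/
theorem boxPerim_succ_dim (m ℓ : ℕ) {d : ℕ} (h : ℓ ≤ d) :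
    boxPerim m ℓ (d + 1) = 2 * pc m ℓ d + m * boxPerim m ℓ d := by
  obtain ⟨r, rfl⟩ : ∃ r, d = ℓ + r := ⟨d - ℓ, by omega⟩
  unfold boxPerim
  rw [show ℓ + r + 1 - 1 = ℓ + r by omega, show ℓ + r + 1 - ℓ = r + 1 by omega,
    show ℓ + r - ℓ = r by omega, pc_add]
  rcases Nat.eq_zero_or_pos r with rfl | hr
  · rcases Nat.eq_zero_or_pos ℓ with rfl | hℓ
    · simp [pc]
    · obtain ⟨t, rfl⟩ : ∃ t, ℓ = t + 1 := ⟨ℓ - 1, by omega⟩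
      rw [show t + 1 + 0 = t + 1 by omega, show t + 1 - 1 = t by omega, pc_add, pc_self]
      ring
  · obtain ⟨s, rfl⟩ : ∃ s, r = s + 1 := ⟨r - 1, by omega⟩
    rw [show ℓ + (s + 1) - 1 = ℓ + s by omega, pc_add]
    rcases Nat.eq_zero_or_pos ℓ with rfl | hℓ
    · ring
    · obtain ⟨t, rfl⟩ : ∃ t, ℓ = t + 1 := ⟨ℓ - 1, by omega⟩
      rw [show t + 1 - 1 = t by omega, show t + 1 + (s + 1) = t + (s + 2) by omega, pc_add,
        show t + 1 + s = t + (s + 1) by omega, pc_add]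
      ring

/-- **The cubicle cost `cubicleCost d n`** = sum of the box perimeters over the pseudo-cubic
representation of `n` (`boxPerim(m_d,ℓ_d,d) + cubicleCost (d−1) n'`): the edge perimeter `#Θ_d` of
Agnarsson–Lauria's cubicle `⟦n⟧^d`, i.e. `2dn − 2F_d(n) = 2δ_d(n)` of [AL13] Observation 5.12
(boundary form of eq. (F(n)-rec)/(F(n)-sum)).  [AL13] Theorem 6.4 asserts that this is the optimum
`EIP^d(n)`; that is NOT proved here. [cite: AgnarssonLauria2013, Observation 5.12 and eq. (F(n)-rec)] -/
def cubicleCost : ℕ → ℕ → ℕ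
  | 0, _ => 0
  | d + 1, n =>
    if n = 0 then 0
    else boxPerim (iroot (d + 1) n) (plead (d + 1) n) (d + 1) + cubicleCost d (prem (d + 1) n)

/-- `cubicleCost d 0 = 0`. [cite: AgnarssonLauria2013, §5 (⟦0⟧ = ∅)] -/
@[simp] theorem cubicleCost_zero (d : ℕ) : cubicleCost d 0 = 0 := by
  cases d <;> simp [cubicleCost]

/-- `cubicleCost 0 n = 0` (`ℤ⁰` has no edges). [cite: AgnarssonLauria2013, §5] -/
@[simp] theorem cubicleCost_dim_zero (n : ℕ) : cubicleCost 0 n = 0 := by simp [cubicleCost]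

/-- Unfolding at `n ≠ 0`. [cite: AgnarssonLauria2013, eq. (F(n)-rec)] -/
theorem cubicleCost_succ (d : ℕ) {n : ℕ} (hn : n ≠ 0) :
    cubicleCost (d + 1) n =
      boxPerim (iroot (d + 1) n) (plead (d + 1) n) (d + 1) + cubicleCost d (prem (d + 1) n) := by
  rw [cubicleCost, if_neg hn]

variable {d : ℕ}

/-- **[AL13] eq. (F(n)-rec) in boundary form**: for `m ≥ 1`, `ℓ ≤ d − 1` and
`[m,ℓ]^d ≤ n < [m,ℓ+1]^d`, `cubicleCost d n = boxPerim m ℓ d + cubicleCost (d−1) (n − [m,ℓ]^d)`.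
[cite: AgnarssonLauria2013, eq. (F(n)-rec)] -/
theorem cubicleCost_eq (hd : 1 ≤ d) {n m ℓ : ℕ} (hm : 1 ≤ m) (hℓ : ℓ ≤ d - 1)
    (h1 : pc m ℓ d ≤ n) (h2 : n < pc m (ℓ + 1) d) :
    cubicleCost d n = boxPerim m ℓ d + cubicleCost (d - 1) (n - pc m ℓ d) := by
  obtain ⟨e, rfl⟩ : ∃ e, d = e + 1 := ⟨d - 1, by omega⟩
  have hn : n ≠ 0 := by have := pc_pos hm ℓ (e + 1); omega
  obtain ⟨hi, hp⟩ := iroot_plead_unique (d := e + 1) hd hℓ h1 h2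
  rw [cubicleCost_succ e hn]
  unfold prem
  rw [hi, hp, Nat.add_sub_cancel]

/-- The cubicle of a pseudo-cubic number is the pseudo-cube: `cubicleCost d [m,ℓ]^d = boxPerim m ℓ d`
(`m ≥ 1`, `ℓ ≤ d − 1`). [cite: AgnarssonLauria2013, §5 (⟦[m,ℓ]^d⟧ = ⟦m,ℓ⟧^d) and eq. (F(pc)-exactl)] -/
theorem cubicleCost_pc (hd : 1 ≤ d) {m ℓ : ℕ} (hm : 1 ≤ m) (hℓ : ℓ ≤ d - 1) :
    cubicleCost d (pc m ℓ d) = boxPerim m ℓ d := by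
  rw [cubicleCost_eq hd hm hℓ le_rfl
    (by rw [pc_succ m ℓ (by omega)]; exact Nat.lt_add_of_pos_right (pc_pos hm _ _)),
    Nat.sub_self, cubicleCost_zero, add_zero]

/-- … also in the conventional case `ℓ = d`: `cubicleCost d (m+1)^d = boxPerim m d d`.
[cite: AgnarssonLauria2013, Definition 5.1 (remark (ii)) and eq. (F(pc)-exactl)] -/
theorem cubicleCost_pc_self (hd : 1 ≤ d) (m : ℕ) : cubicleCost d (pc m d d) = boxPerim m d d := by
  rw [pc_self, boxPerim_self, ← pc_zero_left, cubicleCost_pc hd (by omega) (Nat.zero_le _)]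

/-- `cubicleCost d [m,ℓ+1]^d = boxPerim m ℓ d + cubicleCost (d−1) [m,ℓ]^{d−1}` (`m ≥ 1`, `ℓ ≤ d−1`):
eq. (F(pc)-rec) for the cubicle cost, including the conventional top case `ℓ + 1 = d`.
[cite: AgnarssonLauria2013, eq. (F(pc)-rec)] -/
theorem cubicleCost_pc_succ (hd : 1 ≤ d) {m ℓ : ℕ} (hm : 1 ≤ m) (hℓ : ℓ ≤ d - 1) :
    cubicleCost d (pc m (ℓ + 1) d) = boxPerim m ℓ d + cubicleCost (d - 1) (pc m ℓ (d - 1)) := by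
  obtain ⟨e, rfl⟩ : ∃ e, d = e + 1 := ⟨d - 1, by omega⟩
  rw [Nat.add_sub_cancel] at hℓ ⊢
  by_cases h : ℓ + 1 ≤ e
  · rw [cubicleCost_pc hd hm (by omega), boxPerim_succ m ℓ (by omega), Nat.add_sub_cancel,
      cubicleCost_pc (by omega) hm (by omega)]
  · have hℓe : ℓ = e := by omega
    subst hℓe
    rw [cubicleCost_pc_self hd, boxPerim_succ m ℓ le_rfl, Nat.add_sub_cancel]
    rcases Nat.eq_zero_or_pos ℓ with rfl | hpos
    · simp [boxPerim]
    · rw [cubicleCost_pc_self hpos]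

/-- **The cost of a pseudo-cube plus a small layer**: for `m ≥ 1`, `ℓ ≤ d − 1` and `b ≤ [m,ℓ]^{d−1}`,
`cubicleCost d ([m,ℓ]^d + b) = boxPerim m ℓ d + cubicleCost (d−1) b` — eq. (F(n)-rec) for
`b < [m,ℓ]^{d−1}` and eq. (F(pc)-rec) in the extreme case `b = [m,ℓ]^{d−1}` (then
`[m,ℓ]^d + b = [m,ℓ+1]^d`). [cite: AgnarssonLauria2013, eq. (F(n)-rec) and (F(pc)-rec)] -/
theorem cubicleCost_pc_add (hd : 1 ≤ d) {m ℓ b : ℕ} (hm : 1 ≤ m) (hℓ : ℓ ≤ d - 1)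
    (hb : b ≤ pc m ℓ (d - 1)) :
    cubicleCost d (pc m ℓ d + b) = boxPerim m ℓ d + cubicleCost (d - 1) b := by
  rcases hb.lt_or_eq with hb | rfl
  · rw [cubicleCost_eq hd hm hℓ (Nat.le_add_right _ _) (by rw [pc_succ m ℓ (by omega)]; omega),
      Nat.add_sub_cancel_left]
  · rw [← pc_succ m ℓ (by omega), cubicleCost_pc_succ hd hm hℓ]

/-- `cubicleCost 1 n = 2` for `n ≥ 1` (an interval). [cite: AgnarssonLauria2013, §5 (d = 1)] -/
theorem cubicleCost_one {n : ℕ} (hn : 1 ≤ n) : cubicleCost 1 n = 2 := by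
  have h := cubicleCost_pc (d := 1) le_rfl hn (ℓ := 0) le_rfl
  rwa [pc_zero_left, pow_one, boxPerim_dim_one] at h

end Cost

/-! ### More PCR bookkeeping: dimension one, small numbers, and the PCR of `n + 1` -/

section PCR2

variable {d : ℕ}

/-- `iroot 1 n = n`. [cite: AgnarssonLauria2013, Proposition 5.3 (d = 1)] -/
@[simp] theorem iroot_one (n : ℕ) : iroot 1 n = n :=
  iroot_eq_of_bounds le_rfl (by rw [pow_one]) (by rw [pow_one]; exact Nat.lt_succ_self n)

/-- `plead 1 n = 0`. [cite: AgnarssonLauria2013, Proposition 5.3 (d = 1)] -/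
@[simp] theorem plead_one (n : ℕ) : plead 1 n = 0 := Nat.le_zero.1 (plead_le 1 n)

/-- **Numbers below a pseudo-cubic have a lexicographically smaller leading term**: if
`M < [m,ℓ]^d` (`ℓ + 1 ≤ d`) then `m_d(M) ≤ m`, and `m_d(M) = m` forces `ℓ_d(M) < ℓ`.
[cite: AgnarssonLauria2013, Observation 5.4] -/
theorem iroot_le_of_lt_pc (hd : 1 ≤ d) {M m ℓ : ℕ} (hℓ : ℓ + 1 ≤ d) (hM : M < pc m ℓ d) :
    iroot d M ≤ m ∧ (iroot d M = m → plead d M < ℓ) := by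
  have h1 : M < (m + 1) ^ d := lt_of_lt_of_le hM (pc_le_succ_pow m (by omega))
  have h2 := iroot_pow_le hd M
  refine ⟨?_, fun h => ?_⟩
  · by_contra hc
    push Not at hc
    have := Nat.pow_le_pow_left (show m + 1 ≤ iroot d M by omega) d
    omega
  · by_contra hc
    push Not at hc
    have h3 := pc_plead_le hd M
    rw [h] at h3
    have h4 := pc_mono_right m hc (show plead d M ≤ d from (plead_le d M).trans (by omega))
    omega

/-- The PCR of `N + 1` when the remainder can still grow: same leading term, remainder `n' + 1`.
[cite: AgnarssonLauria2013, Observation 5.4 and Proposition 5.7 (i)] -/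
theorem pcr_succ_of_lt (hd : 1 ≤ d) {N : ℕ} (h : prem d N + 1 < pdelta d N) :
    iroot d (N + 1) = iroot d N ∧ plead d (N + 1) = plead d N ∧
      prem d (N + 1) = prem d N + 1 := by
  have h0 := pc_add_prem hd N
  have hℓ := plead_le d N
  unfold pdelta at h
  obtain ⟨h1, h2⟩ := iroot_plead_unique hd (n := N + 1) (m := iroot d N) (ℓ := plead d N) hℓ
    (by omega) (by rw [pc_succ _ _ (show plead d N + 1 ≤ d by omega)]; unfold prem at h; omega)
  refine ⟨h1, h2, ?_⟩
  unfold prem at h0 ⊢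
  rw [h1, h2]
  omega

/-- The PCR of `N + 1` when the remainder is full and `ℓ + 2 ≤ d`: leading term `[m,ℓ+1]^d`,
remainder `0`. [cite: AgnarssonLauria2013, Claim 5.2 and Observation 5.4] -/
theorem pcr_succ_of_eq (hd : 1 ≤ d) {N : ℕ} (hN : 1 ≤ N) (h : prem d N + 1 = pdelta d N)
    (hℓ : plead d N + 2 ≤ d) :
    iroot d (N + 1) = iroot d N ∧ plead d (N + 1) = plead d N + 1 ∧ prem d (N + 1) = 0 := by
  have h0 := pc_add_prem hd N
  have hm : 1 ≤ iroot d N := iroot_pos hd hN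
  unfold pdelta at h
  unfold prem at h h0
  have hN1 : N + 1 = pc (iroot d N) (plead d N + 1) d := by
    rw [pc_succ _ _ (show plead d N + 1 ≤ d by omega)]; omega
  obtain ⟨h1, h2⟩ := iroot_plead_unique hd (n := N + 1) (m := iroot d N) (ℓ := plead d N + 1)
    (by omega) hN1.symm.le
    (by rw [hN1, pc_succ _ (plead d N + 1) (show plead d N + 1 + 1 ≤ d by omega)]
        exact Nat.lt_add_of_pos_right (pc_pos hm _ _))
  refine ⟨h1, h2, ?_⟩
  unfold prem
  rw [h1, h2]
  omega

/-- The PCR of `N + 1` when the remainder is full and `ℓ = d − 1`: `N + 1 = (m+1)^d = [m+1,0]^d`.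
[cite: AgnarssonLauria2013, Definition 5.1 (remark (ii)) and Observation 5.4] -/
theorem pcr_succ_top (hd : 1 ≤ d) {N : ℕ} (h : prem d N + 1 = pdelta d N)
    (hℓ : plead d N = d - 1) :
    iroot d (N + 1) = iroot d N + 1 ∧ plead d (N + 1) = 0 ∧ prem d (N + 1) = 0 := by
  have h0 := pc_add_prem hd N
  unfold pdelta at h
  unfold prem at h h0
  rw [hℓ] at h h0
  have hN1 : N + 1 = pc (iroot d N + 1) 0 d := by
    have := pc_succ (iroot d N) (d - 1) (d := d) (by omega)
    rw [show d - 1 + 1 = d by omega, pc_self] at this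
    rw [pc_zero_left]
    omega
  obtain ⟨h1, h2⟩ := iroot_plead_unique hd (n := N + 1) (m := iroot d N + 1) (ℓ := 0)
    (Nat.zero_le _) hN1.symm.le
    (by rw [hN1, pc_succ _ 0 (show 0 + 1 ≤ d by omega)]
        exact Nat.lt_add_of_pos_right (pc_pos (by omega) _ _))
  refine ⟨h1, h2, ?_⟩
  unfold prem
  rw [h1, h2]
  omega

/-- Either the remainder of `N` can grow, or `N + 1` is the next pseudo-cubic.
[cite: AgnarssonLauria2013, §5 Notation (i)–(ii)] -/
theorem prem_succ_lt_or_eq (hd : 1 ≤ d) (N : ℕ) :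
    prem d N + 1 < pdelta d N ∨ prem d N + 1 = pdelta d N := by
  have := prem_lt_pdelta hd N
  omega

end PCR2

/-! ### Cubicle profiles: the slices of `⟦N⟧^{d+1}` ([AL13] Definition 5.8 along the last axis) -/

section Profile

/-- **The cubicle profile** `cubicleSlices d N : ℕ → ℕ`: the cardinalities of the slices of
Agnarsson–Lauria's cubicle `⟦N⟧^d ⊂ ℕ^d` perpendicular to the last axis, listed bottom-up
(non-increasing).  From eq. (cubicle-rec), `⟦N⟧^d = ⟦m,ℓ⟧^d ∪ λ_{ℓ+1;m+1}(⟦n'⟧^{d−1})` with the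
pseudo-cube `[m+1]^ℓ × [m]^{d−ℓ}` having `m` slices `[m,ℓ]^{d−1}`: if `ℓ ≤ d − 2` the attached
`(d−1)`-cubicle lies in the side hyperplane `x_{ℓ+1} = m+1` and contributes its own profile slice by
slice (`k ↦ [m,ℓ]^{d−1} + profile(⟦n'⟧^{d−1})(k)`, `k < m`); if `ℓ = d − 1` it IS the top slice
(`[m,d−1]^{d−1} = (m+1)^{d−1}` for `k < m`, then `n'`).  In dimension `1`, `⟦N⟧¹` is an interval of
`N` unit slices. [cite: AgnarssonLauria2013, Definition 5.8 and eq. (cubicle-rec)] -/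
def cubicleSlices : ℕ → ℕ → ℕ → ℕ
  | 0, _, _ => 0
  | 1, N, k => if k < N then 1 else 0
  | d + 2, N, k =>
    if N = 0 then 0
    else if plead (d + 2) N < d + 1 then
      (if k < iroot (d + 2) N then
        pc (iroot (d + 2) N) (plead (d + 2) N) (d + 1) + cubicleSlices (d + 1) (prem (d + 2) N) k
      else 0)
    else
      (if k < iroot (d + 2) N then pc (iroot (d + 2) N) (plead (d + 2) N) (d + 1)
      else if k = iroot (d + 2) N then prem (d + 2) N else 0)

/-- Dimension one: `N` unit slices. [cite: AgnarssonLauria2013, Definition 5.8 (d = 1)] -/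
theorem cubicleSlices_one (N k : ℕ) : cubicleSlices 1 N k = if k < N then 1 else 0 := rfl

/-- The empty cubicle has the zero profile. [cite: AgnarssonLauria2013, §5 (⟦0⟧ = ∅)] -/
@[simp] theorem cubicleSlices_zero_right (d k : ℕ) : cubicleSlices d 0 k = 0 := by
  rcases d with _ | _ | d <;> simp [cubicleSlices]

/-- Unfolding, case `ℓ ≤ d` (the attached cubicle is lateral). [cite: AgnarssonLauria2013, eq. (cubicle-rec)] -/
theorem cubicleSlices_of_lt {d N : ℕ} (hN : N ≠ 0) (h : plead (d + 2) N < d + 1) (k : ℕ) :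
    cubicleSlices (d + 2) N k =
      if k < iroot (d + 2) N then
        pc (iroot (d + 2) N) (plead (d + 2) N) (d + 1) + cubicleSlices (d + 1) (prem (d + 2) N) k
      else 0 := by
  rw [cubicleSlices, if_neg hN, if_pos h]

/-- Unfolding, case `ℓ = d + 1` (the attached cubicle is the top slice). [cite: AgnarssonLauria2013, eq. (cubicle-rec)] -/
theorem cubicleSlices_of_not_lt {d N : ℕ} (hN : N ≠ 0) (h : ¬ plead (d + 2) N < d + 1) (k : ℕ) :
    cubicleSlices (d + 2) N k =
      if k < iroot (d + 2) N then pc (iroot (d + 2) N) (plead (d + 2) N) (d + 1)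
      else if k = iroot (d + 2) N then prem (d + 2) N else 0 := by
  rw [cubicleSlices, if_neg hN, if_neg h]

/-- **Support** (dimensions `≥ 2`): the profile of `⟦N⟧^{d+2}` vanishes above height `m_{d+2}(N)`.
[cite: AgnarssonLauria2013, §5 (⟦N⟧^d ⊆ ⟦m_d+1,0⟧^d)] -/
theorem cubicleSlices_eq_zero_of_lt {d N k : ℕ} (hk : iroot (d + 2) N < k) :
    cubicleSlices (d + 2) N k = 0 := by
  by_cases hN : N = 0
  · rw [hN, cubicleSlices_zero_right]
  by_cases h : plead (d + 2) N < d + 1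
  · rw [cubicleSlices_of_lt hN h, if_neg (by omega)]
  · rw [cubicleSlices_of_not_lt hN h, if_neg (by omega), if_neg (by omega)]

/-- … and already at height `m_{d+2}(N)` unless the top slice is the attached cubicle.
[cite: AgnarssonLauria2013, eq. (cubicle-rec)] -/
theorem cubicleSlices_eq_zero_of_le {d N k : ℕ} (h : plead (d + 2) N < d + 1)
    (hk : iroot (d + 2) N ≤ k) : cubicleSlices (d + 2) N k = 0 := by
  by_cases hN : N = 0
  · rw [hN, cubicleSlices_zero_right]
  rw [cubicleSlices_of_lt hN h, if_neg (by omega)]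

/-- Support in every dimension `d + 1 ≥ 1`: the profile vanishes above height `m_{d+1}(N)`.
[cite: AgnarssonLauria2013, §5 (⟦N⟧^d ⊆ ⟦m_d+1,0⟧^d)] -/
theorem cubicleSlices_eq_zero_of_lt' {d N k : ℕ} (hk : iroot (d + 1) N < k) :
    cubicleSlices (d + 1) N k = 0 := by
  rcases d with _ | d
  · rw [iroot_one] at hk
    rw [cubicleSlices_one, if_neg (by omega)]
  · exact cubicleSlices_eq_zero_of_lt hk

/-- **Sums beyond the support agree.** [cite: AgnarssonLauria2013, Proposition 5.7 (i)] -/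
private theorem sum_range_eq_sum_range {f : ℕ → ℕ} {a b : ℕ} (h : ∀ k, min a b ≤ k → f k = 0) :
    ∑ k ∈ range a, f k = ∑ k ∈ range b, f k := by
  wlog hab : a ≤ b generalizing a b
  · exact (this (fun k hk => h k (by rw [min_comm]; exact hk)) (by omega)).symm
  rw [min_eq_left hab] at h
  rw [← sum_range_add_sum_Ico _ hab]
  have : ∑ k ∈ Ico a b, f k = 0 := sum_eq_zero fun k hk => h k (mem_Ico.1 hk).1
  rw [this, add_zero]

/-- **Profiles of small numbers are short**: if `M < [m,ℓ]^{d+1}` with `ℓ ≤ d`, the profile of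
`⟦M⟧^{d+1}` vanishes from height `m` on (`⟦M⟧^{d+1} ⊆ ⟦m,ℓ⟧^{d+1}`, whose last side is `m`).
[cite: AgnarssonLauria2013, Proposition 5.7 (ii) and Lemma 5.10 (|π_i ⟦n⟧^d| = m_d)] -/
theorem cubicleSlices_eq_zero_of_lt_pc {d M m ℓ : ℕ} (hℓ : ℓ ≤ d) (hM : M < pc m ℓ (d + 1))
    {k : ℕ} (hk : m ≤ k) : cubicleSlices (d + 1) M k = 0 := by
  rcases d with _ | d
  · have hℓ0 : ℓ = 0 := by omega
    subst hℓ0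
    rw [pc_zero_left, pow_one] at hM
    rw [cubicleSlices_one, if_neg (by omega)]
  · obtain ⟨h1, h2⟩ := iroot_le_of_lt_pc (d := d + 2) (by omega) (by omega) hM
    rcases h1.lt_or_eq with h1 | h1
    · exact cubicleSlices_eq_zero_of_lt (by omega)
    · exact cubicleSlices_eq_zero_of_le (by have := h2 h1; omega) (by omega)

/-- `Σ_k cubicleSlices 1 N k = N` (the interval). [cite: AgnarssonLauria2013, Proposition 5.7 (i) (d = 1)] -/
theorem sum_cubicleSlices_one (N : ℕ) :
    ∑ k ∈ range (iroot 1 N + 1), cubicleSlices 1 N k = N := by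
  have h : ∀ k ∈ range N, cubicleSlices 1 N k = 1 := fun k hk => by
    rw [cubicleSlices_one, if_pos (mem_range.1 hk)]
  rw [iroot_one, sum_range_succ, sum_congr rfl h, sum_const, card_range, smul_eq_mul, mul_one,
    cubicleSlices_one, if_neg (lt_irrefl N), add_zero]

/-- **`Σ_k cubicleSlices (d+1) N k = N`**: the slices of `⟦N⟧^{d+1}` have `N` points in total
(`|⟦n⟧^d| = n`). [cite: AgnarssonLauria2013, Proposition 5.7 (i)] -/
theorem sum_cubicleSlices (d N : ℕ) :
    ∑ k ∈ range (iroot (d + 1) N + 1), cubicleSlices (d + 1) N k = N := by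
  induction d generalizing N with
  | zero => exact sum_cubicleSlices_one N
  | succ d ih =>
    show ∑ k ∈ range (iroot (d + 2) N + 1), cubicleSlices (d + 2) N k = N
    by_cases hN : N = 0
    · rw [hN]; simp
    have hpc := pc_add_prem (d := d + 2) (by omega) N
    have hN'lt : prem (d + 2) N < pc (iroot (d + 2) N) (plead (d + 2) N) (d + 1) :=
      prem_lt_pdelta (d := d + 2) (by omega) N
    set m := iroot (d + 2) N with hm
    set ℓ := plead (d + 2) N with hℓ
    set N' := prem (d + 2) N with hN'
    have hℓle : ℓ ≤ d + 1 := plead_le (d + 2) N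
    by_cases h : ℓ < d + 1
    · simp only [cubicleSlices_of_lt hN h]
      rw [sum_range_succ, if_neg (lt_irrefl _), add_zero,
        sum_congr rfl fun k hk => if_pos (mem_range.1 hk), sum_add_distrib, sum_const, card_range,
        smul_eq_mul, mul_pc m ℓ (by omega)]
      have hs : ∑ k ∈ range m, cubicleSlices (d + 1) N' k = N' := by
        calc ∑ k ∈ range m, cubicleSlices (d + 1) N' k
            = ∑ k ∈ range (iroot (d + 1) N' + 1), cubicleSlices (d + 1) N' k := by
              refine sum_range_eq_sum_range fun k hk => ?_
              by_cases hmk : m ≤ k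
              · exact cubicleSlices_eq_zero_of_lt_pc (by omega) hN'lt hmk
              · exact cubicleSlices_eq_zero_of_lt' (by
                  have := min_le_iff.1 hk
                  omega)
          _ = N' := ih N'
      rw [hs]
      exact hpc
    · simp only [cubicleSlices_of_not_lt hN h]
      rw [sum_range_succ, if_neg (lt_irrefl _), if_pos rfl,
        sum_congr rfl fun k hk => if_pos (mem_range.1 hk), sum_const, card_range, smul_eq_mul,
        mul_pc m ℓ (by omega)]
      exact hpc

/-- The profile of an interval is non-increasing. [cite: AgnarssonLauria2013, Proposition 5.7 (iii) (d = 1)] -/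
theorem cubicleSlices_one_antitone (N : ℕ) : Antitone (cubicleSlices 1 N) := by
  intro k k' hkk'
  rw [cubicleSlices_one, cubicleSlices_one]
  split_ifs <;> omega

/-- **The profile is non-increasing** (bottom slices are the largest). [cite: AgnarssonLauria2013, Proposition 5.7 (iii) (⟦n⟧^d is fully nested)] -/
theorem cubicleSlices_antitone (d N : ℕ) : Antitone (cubicleSlices (d + 1) N) := by
  induction d generalizing N with
  | zero => exact cubicleSlices_one_antitone N
  | succ d ih =>
    show Antitone (cubicleSlices (d + 2) N)
    intro k k' hkk'
    by_cases hN : N = 0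
    · rw [hN, cubicleSlices_zero_right, cubicleSlices_zero_right]
    have hN'lt : prem (d + 2) N < pc (iroot (d + 2) N) (plead (d + 2) N) (d + 1) :=
      prem_lt_pdelta (d := d + 2) (by omega) N
    by_cases h : plead (d + 2) N < d + 1
    · rw [cubicleSlices_of_lt hN h, cubicleSlices_of_lt hN h]
      by_cases hk' : k' < iroot (d + 2) N
      · rw [if_pos hk', if_pos (lt_of_le_of_lt hkk' hk')]
        exact Nat.add_le_add_left (ih _ hkk') _
      · rw [if_neg hk']; exact Nat.zero_le _
    · rw [cubicleSlices_of_not_lt hN h, cubicleSlices_of_not_lt hN h]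
      by_cases hk' : k' < iroot (d + 2) N
      · rw [if_pos hk', if_pos (lt_of_le_of_lt hkk' hk')]
      · rw [if_neg hk']
        by_cases hk'e : k' = iroot (d + 2) N
        · rw [if_pos hk'e]
          by_cases hk : k < iroot (d + 2) N
          · rw [if_pos hk]; exact hN'lt.le
          · rw [if_neg hk, if_pos (by omega)]
        · rw [if_neg hk'e]; exact Nat.zero_le _

/-- Slices of an interval are single points. [cite: AgnarssonLauria2013, Lemma 5.10 (d = 1)] -/
theorem cubicleSlices_one_le (N k : ℕ) :
    cubicleSlices 1 N k ≤ pc (iroot 1 N) (min (plead 1 N + 1) 0) 0 := by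
  rw [cubicleSlices_one, Nat.min_zero, pc_zero_left, pow_zero]
  split_ifs <;> omega

/-- **Size of the slices**: every slice of `⟦N⟧^{d+1}` has at most `[m, min(ℓ+1,d)]^d` points (it lies
in the bottom slice of the next pseudo-cube `[m,ℓ+1]^{d+1}`, resp. of `[m+1]^{d+1}`).
[cite: AgnarssonLauria2013, Proposition 5.7 (ii) (⟦n⟧ ⊆ ⟦[n]_+⟧) and Lemma 5.10] -/
theorem cubicleSlices_le (d N k : ℕ) :
    cubicleSlices (d + 1) N k ≤ pc (iroot (d + 1) N) (min (plead (d + 1) N + 1) d) d := by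
  induction d generalizing N k with
  | zero => exact cubicleSlices_one_le N k
  | succ d ih =>
    show cubicleSlices (d + 2) N k ≤ pc (iroot (d + 2) N) (min (plead (d + 2) N + 1) (d + 1)) (d + 1)
    by_cases hN : N = 0
    · rw [hN, cubicleSlices_zero_right]; exact Nat.zero_le _
    have hN'lt : prem (d + 2) N < pc (iroot (d + 2) N) (plead (d + 2) N) (d + 1) :=
      prem_lt_pdelta (d := d + 2) (by omega) N
    have hℓle : plead (d + 2) N ≤ d + 1 := plead_le (d + 2) N
    by_cases h : plead (d + 2) N < d + 1
    · rw [cubicleSlices_of_lt hN h, min_eq_left (by omega : plead (d + 2) N + 1 ≤ d + 1)]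
      split_ifs with hk
      · rw [pc_succ _ _ (show plead (d + 2) N + 1 ≤ d + 1 by omega), Nat.add_sub_cancel]
        exact Nat.add_le_add_left (cubicleSlices_le_of_lt_pc' ih (by omega) hN'lt k) _
      · exact Nat.zero_le _
    · have hℓ' : plead (d + 2) N = d + 1 := by omega
      rw [cubicleSlices_of_not_lt hN h, hℓ', min_eq_right (by omega : d + 1 ≤ d + 1 + 1)]
      rw [hℓ'] at hN'lt
      split_ifs
      · exact le_rfl
      · exact hN'lt.le
      · exact Nat.zero_le _
  where
  /-- The corollary below, relative to the induction hypothesis. -/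
  cubicleSlices_le_of_lt_pc' {d : ℕ}
      (ih : ∀ N k, cubicleSlices (d + 1) N k ≤ pc (iroot (d + 1) N) (min (plead (d + 1) N + 1) d) d)
      {M m ℓ : ℕ} (hℓ : ℓ ≤ d) (hM : M < pc m ℓ (d + 1)) (k : ℕ) :
      cubicleSlices (d + 1) M k ≤ pc m ℓ d := by
    by_cases hM0 : M = 0
    · rw [hM0, cubicleSlices_zero_right]; exact Nat.zero_le _
    refine (ih M k).trans ?_
    obtain ⟨h1, h2⟩ := iroot_le_of_lt_pc (d := d + 1) (by omega) (by omega) hM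
    rcases h1.lt_or_eq with h1 | h1
    · exact pc_le_pc_of_lt _ h1 (min_le_right _ _) ℓ hℓ
    · rw [h1]
      exact pc_mono_right m ((min_le_left _ _).trans (h2 h1)) hℓ

/-- Corollary: if `M < [m,ℓ]^{d+1}` (`ℓ ≤ d`), every slice of `⟦M⟧^{d+1}` has at most `[m,ℓ]^d`
points. [cite: AgnarssonLauria2013, Proposition 5.7 (ii)] -/
theorem cubicleSlices_le_of_lt_pc {d M m ℓ : ℕ} (hℓ : ℓ ≤ d) (hM : M < pc m ℓ (d + 1)) (k : ℕ) :
    cubicleSlices (d + 1) M k ≤ pc m ℓ d :=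
  cubicleSlices_le.cubicleSlices_le_of_lt_pc' (cubicleSlices_le d) hℓ hM k

/-- Intervals are nested. [cite: AgnarssonLauria2013, Proposition 5.7 (ii) (d = 1)] -/
theorem cubicleSlices_one_mono (N k : ℕ) : cubicleSlices 1 N k ≤ cubicleSlices 1 (N + 1) k := by
  rw [cubicleSlices_one, cubicleSlices_one]
  split_ifs <;> omega

/-- **Cubicle profiles are nested**: `cubicleSlices (d+1) N ≤ cubicleSlices (d+1) (N+1)`
pointwise — the slice-wise content of `⟦N⟧^{d+1} ⊆ ⟦N+1⟧^{d+1}`. [cite: AgnarssonLauria2013, Proposition 5.7 (ii)] -/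
theorem cubicleSlices_mono (d N k : ℕ) :
    cubicleSlices (d + 1) N k ≤ cubicleSlices (d + 1) (N + 1) k := by
  induction d generalizing N k with
  | zero => exact cubicleSlices_one_mono N k
  | succ d ih =>
    show cubicleSlices (d + 2) N k ≤ cubicleSlices (d + 2) (N + 1) k
    by_cases hN : N = 0
    · rw [hN, cubicleSlices_zero_right]; exact Nat.zero_le _
    have hN1 : 1 ≤ N := Nat.one_le_iff_ne_zero.2 hN
    have hN1' : N + 1 ≠ 0 := by omega
    have hN'lt : prem (d + 2) N < pc (iroot (d + 2) N) (plead (d + 2) N) (d + 1) :=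
      prem_lt_pdelta (d := d + 2) (by omega) N
    have hℓle : plead (d + 2) N ≤ d + 1 := plead_le (d + 2) N
    rcases prem_succ_lt_or_eq (d := d + 2) (by omega) N with hlt | heq
    · -- same leading term, the remainder grows
      obtain ⟨h1, h2, h3⟩ := pcr_succ_of_lt (d := d + 2) (by omega) hlt
      by_cases h : plead (d + 2) N < d + 1
      · rw [cubicleSlices_of_lt hN h, cubicleSlices_of_lt hN1' (by rw [h2]; exact h), h1, h2, h3]
        split_ifs
        · exact Nat.add_le_add_left (ih _ _) _
        · exact le_rfl
      · rw [cubicleSlices_of_not_lt hN h, cubicleSlices_of_not_lt hN1' (by rw [h2]; exact h),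
          h1, h2, h3]
        split_ifs <;> omega
    · by_cases h : plead (d + 2) N < d + 1
      · rw [cubicleSlices_of_lt hN h]
        by_cases hℓd : plead (d + 2) N + 2 ≤ d + 1
        · -- `N + 1 = [m,ℓ+1]^{d+2}` with `ℓ + 1 ≤ d`: still the lateral case, empty remainder
          obtain ⟨h1, h2, h3⟩ := pcr_succ_of_eq (d := d + 2) (by omega) hN1 heq (by omega)
          rw [cubicleSlices_of_lt hN1' (by rw [h2]; omega), h1, h2, h3, cubicleSlices_zero_right,
            add_zero]
          split_ifs
          · rw [pc_succ _ _ (show plead (d + 2) N + 1 ≤ d + 1 by omega), Nat.add_sub_cancel]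
            exact Nat.add_le_add_left (cubicleSlices_le_of_lt_pc (by omega) hN'lt _) _
          · exact le_rfl
        · -- `ℓ = d`: `N + 1 = [m,d+1]^{d+2}`, the top case with empty remainder
          obtain ⟨h1, h2, h3⟩ := pcr_succ_of_eq (d := d + 2) (by omega) hN1 heq (by omega)
          rw [cubicleSlices_of_not_lt hN1' (by rw [h2]; omega), h1, h2, h3]
          split_ifs
          · rw [pc_succ _ _ (show plead (d + 2) N + 1 ≤ d + 1 by omega), Nat.add_sub_cancel]
            exact Nat.add_le_add_left (cubicleSlices_le_of_lt_pc (by omega) hN'lt _) _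
          · exact le_rfl
          · exact le_rfl
      · -- `ℓ = d + 1`: `N + 1 = (m+1)^{d+2} = [m+1,0]^{d+2}`
        have hℓ' : plead (d + 2) N = d + 1 := by omega
        obtain ⟨h1, h2, h3⟩ := pcr_succ_top (d := d + 2) (by omega) heq (by rw [hℓ']; rfl)
        rw [cubicleSlices_of_not_lt hN h, cubicleSlices_of_lt hN1' (by rw [h2]; omega), h1, h2, h3,
          cubicleSlices_zero_right, add_zero, hℓ', pc_self, pc_zero_left]
        rw [hℓ', pc_self] at hN'lt
        split_ifs <;> omega

end Profile

/-! ### The cost of the cubicle profile is the cubicle cost ([AL13] eq. (F(n)-rec), (F(pc)-sliced)) -/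

section ProfileCost

/-- `cubicleCost (d+2) n` unfolded (the `d + 2` form of `cubicleCost_succ`). [cite: AgnarssonLauria2013, eq. (F(n)-rec)] -/
theorem cubicleCost_succ_succ (d : ℕ) {n : ℕ} (hn : n ≠ 0) :
    cubicleCost (d + 2) n =
      boxPerim (iroot (d + 2) n) (plead (d + 2) n) (d + 2) + cubicleCost (d + 1) (prem (d + 2) n) :=
  cubicleCost_succ (d + 1) hn

/-- Dimension one: the interval `⟦N⟧¹` costs `2`. [cite: AgnarssonLauria2013, §5 (d = 1)] -/
theorem cubicleSlices_one_cost {N : ℕ} (hN : 1 ≤ N) :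
    2 * cubicleSlices 1 N 0 + ∑ k ∈ range (iroot 1 N + 1), cubicleCost 0 (cubicleSlices 1 N k) =
      cubicleCost 1 N := by
  simp only [cubicleCost_dim_zero, sum_const_zero, add_zero]
  rw [cubicleSlices_one, if_pos (by omega), cubicleCost_one hN]

/-- **The stack of `d`-cubicles with the cubicle profile of `N` costs `cubicleCost (d+1) N`**:
`2·e(0) + Σ_k cubicleCost d (e k) = cubicleCost (d+1) N` for `e = cubicleSlices (d+1) N`, `N ≥ 1`
— slice by slice, a slice `[m,ℓ]^d + b` (`b` a slice of the attached cubicle, `b ≤ [m,ℓ]^{d−1}`)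
costs `boxPerim m ℓ d + cubicleCost (d−1) b` (eq. (F(n)-rec)/(F(pc)-rec)), the `m` box terms and
the bottom face `2·[m,ℓ]^d` add up to `boxPerim m ℓ (d+1)` (eq. (F(pc)-sliced)), and the attached
terms to `cubicleCost d n'` by induction.  With `EIP^d = cubicleCost d` ([AL13] Theorem 6.4, not
proved here) this says: the sorted stack of cubicles `⟦e k⟧^d` has edge perimeter `2δ_{d+1}(N)`.
[cite: AgnarssonLauria2013, eq. (F(n)-rec), (F(pc)-sliced) and Observation 5.12] -/
theorem cubicleSlices_cost (d : ℕ) {N : ℕ} (hN : 1 ≤ N) :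
    2 * cubicleSlices (d + 1) N 0 +
        ∑ k ∈ range (iroot (d + 1) N + 1), cubicleCost d (cubicleSlices (d + 1) N k) =
      cubicleCost (d + 1) N := by
  induction d generalizing N with
  | zero => exact cubicleSlices_one_cost hN
  | succ d ih =>
    show 2 * cubicleSlices (d + 2) N 0 +
        ∑ k ∈ range (iroot (d + 2) N + 1), cubicleCost (d + 1) (cubicleSlices (d + 2) N k) =
      cubicleCost (d + 2) N
    have hN0 : N ≠ 0 := by omega
    have hm : 1 ≤ iroot (d + 2) N := iroot_pos (by omega) hN
    have hN'lt : prem (d + 2) N < pc (iroot (d + 2) N) (plead (d + 2) N) (d + 1) :=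
      prem_lt_pdelta (d := d + 2) (by omega) N
    have hℓle : plead (d + 2) N ≤ d + 1 := plead_le (d + 2) N
    rw [cubicleCost_succ_succ d hN0]
    by_cases h : plead (d + 2) N < d + 1
    · simp only [cubicleSlices_of_lt hN0 h]
      set m := iroot (d + 2) N with hmdef
      set ℓ := plead (d + 2) N with hℓdef
      set N' := prem (d + 2) N with hN'def
      rw [if_pos (by omega), sum_range_succ, if_neg (lt_irrefl _), cubicleCost_zero, add_zero,
        sum_congr rfl fun k hk => by rw [if_pos (mem_range.1 hk)]]
      have hterm : ∀ k ∈ range m, cubicleCost (d + 1) (pc m ℓ (d + 1) + cubicleSlices (d + 1) N' k)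
          = boxPerim m ℓ (d + 1) + cubicleCost d (cubicleSlices (d + 1) N' k) := fun k _ =>
        cubicleCost_pc_add (d := d + 1) (by omega) hm (by omega)
          (cubicleSlices_le_of_lt_pc (by omega) hN'lt k)
      rw [sum_congr rfl hterm, sum_add_distrib, sum_const, card_range, smul_eq_mul,
        boxPerim_succ_dim m ℓ (d := d + 1) (by omega)]
      -- the attached cubicle
      have hS : 2 * cubicleSlices (d + 1) N' 0 +
          ∑ k ∈ range m, cubicleCost d (cubicleSlices (d + 1) N' k) = cubicleCost (d + 1) N' := by
        by_cases hN'0 : N' = 0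
        · rw [hN'0]; simp
        calc 2 * cubicleSlices (d + 1) N' 0 + ∑ k ∈ range m, cubicleCost d (cubicleSlices (d + 1) N' k)
            = 2 * cubicleSlices (d + 1) N' 0 +
              ∑ k ∈ range (iroot (d + 1) N' + 1), cubicleCost d (cubicleSlices (d + 1) N' k) := by
              congr 1
              refine sum_range_eq_sum_range fun k hk => ?_
              by_cases hmk : m ≤ k
              · rw [cubicleSlices_eq_zero_of_lt_pc (by omega) hN'lt hmk, cubicleCost_zero]
              · rw [cubicleSlices_eq_zero_of_lt' (by have := min_le_iff.1 hk; omega),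
                  cubicleCost_zero]
          _ = cubicleCost (d + 1) N' := ih (by omega)
      rw [← hS]
      ring
    · have hℓ' : plead (d + 2) N = d + 1 := by omega
      simp only [cubicleSlices_of_not_lt hN0 h]
      rw [hℓ'] at hN'lt ⊢
      set m := iroot (d + 2) N with hmdef
      set N' := prem (d + 2) N with hN'def
      rw [if_pos (by omega), sum_range_succ, if_neg (lt_irrefl _), if_pos rfl,
        sum_congr rfl fun k hk => by rw [if_pos (mem_range.1 hk)], sum_const, card_range, smul_eq_mul,
        cubicleCost_pc_self (d := d + 1) (by omega) m, boxPerim_succ_dim m (d + 1) le_rfl]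
      ring

end ProfileCost

end Literature.MathematicalPhysics.StatisticalMechanics
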